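import Literature.Analysis.FluidPDE.TypeIAncientMild
import Literature.Analysis.FluidPDE.HyperbolicDSSOrbit
import Literature.Analysis.FluidPDE.AncientSimilarityVariables
import Literature.Analysis.FluidPDE.RadialSmoothCutoff
import Literature.Analysis.FluidPDE.WholeSpaceIBP
import Literature.Analysis.FluidPDE.LerayProfileCalculus
import Literature.Analysis.FluidPDE.TaoEnstrophyLocalisationProofs
import Literature.Analysis.FluidPDE.ConstantinDirectionDissipationCalculus
import Literature.Analysis.FluidPDE.VorticityCalculus
import Literature.Analysis.FluidPDE.EnergyToolkit
import Mathlib.Analysis.SpecialFunctions.SmoothTransition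
import Mathlib.MeasureTheory.Measure.Lebesgue.EqHaar
import HarnessLib

/-!
# Crux `MustSqueeze` (stmt-NavierStokesRegularity-11610), line `outward-drift-signed-flux`:
# the div–curl comparison lemmas on balls `stub_divCurlBalls`

In backward similarity variables `U = lerayOrbit u`, `Ω = lerayVorticity u = curl U`, with the
radial cutoff `φ_R(y) = smoothTransition (2 − ‖y‖²/R²)` (`= 1` on `B_R`, `= 0` off `B_{2R}`,
`‖∇φ_R‖ ≤ c/R`), the localised enstrophy `Z_R(s) = ∫ φ_R |Ω(s)|²` and the ball gradient energies
`E(ρ, s) = ∫_{B_ρ} |∇U(s)|²_F` compare as follows (for every `R > 0`):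
(i) `Z_R ≤ 6 E(2R)` (pointwise `|curl U|² ≤ 2 |∇U|²_F`, `0 ≤ φ_R ≤ 1`);
(ii) `∫ φ_R |∇U|²_F ≤ Z_R + c √(2C) √(E(2R)/R)`: pointwise `|∇U|²_F = |curl U|² + tr (∇U ∘ ∇U)`,
`tr (∇U ∘ ∇U) = div ((U·∇)U)` for the divergence-free slice, one integration by parts against the
cutoff, the flux bound `(c/R) √(E(2R)) √(∫_{B_{2R}} ‖U‖²)` (Cauchy–Schwarz on `B_{2R}`) and the
Morrey bound `∫_{B_{2R}} ‖U‖² ≤ 2CR`;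
(iii) `E(R) ≤ ∫ φ_R |∇U|²_F` (`φ_R = 1` on `B_R`);
(iv) `Z_R ≤ Z_{R'}` for `R ≤ R'` (ordered cutoffs).
-/

noncomputable section

open MeasureTheory Set Metric Filter Real
open scoped RealInnerProductSpace

namespace Summit.NavierStokesRegularity.NavierStokesRegularity.Theorems

open Literature.Analysis.FluidPDE

/-- Physical / similarity space `ℝ³`. -/
local notation "ℝ³" => EuclideanSpace ℝ (Fin 3)

/-! ## Regularity and integrability of the densities -/

/-- Slices `U(s, ·)` of the similarity orbit of a class element are `C^n` (the orbit is jointly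
smooth, `contDiff_uncurry_lerayOrbit`; compose with `y ↦ (s, y)`). [folklore] -/
private theorem divCurl_contDiff_lerayOrbit_slice {C : ℝ} {u : ℝ → ℝ³ → ℝ³}
    (hu : IsTypeIAncientMild C u) (s : ℝ) {n : ℕ∞} : ContDiff ℝ n (lerayOrbit u s) :=
  (contDiff_uncurry_lerayOrbit (hu.contDiffOn.of_le (by exact_mod_cast le_top))).comp
    (contDiff_prodMk_right s)

/-- The Frobenius gradient density `y ↦ |∇U(s, y)|²_F` of a slice is continuous. [folklore] -/
private theorem divCurl_continuous_frobeniusNormSq_fderiv_lerayOrbit {C : ℝ} {u : ℝ → ℝ³ → ℝ³}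
    (hu : IsTypeIAncientMild C u) (s : ℝ) :
    Continuous fun y => frobeniusNormSq (fderiv ℝ (lerayOrbit u s) y) :=
  continuous_frobeniusNormSq_fderiv (divCurl_contDiff_lerayOrbit_slice hu s (n := 1)) one_ne_zero

/-- An open ball of `ℝ³` and the closed ball agree up to a null set (the sphere is
Lebesgue-null). [folklore] -/
private theorem divCurl_ball_ae_eq_closedBall (ρ : ℝ) :
    (ball (0 : ℝ³) ρ : Set ℝ³) =ᵐ[volume] (closedBall (0 : ℝ³) ρ : Set ℝ³) := by
  rw [← ball_union_sphere]
  exact (union_ae_eq_left_of_ae_eq_empty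
    (ae_eq_empty.2 (Measure.addHaar_sphere volume _ _))).symm

-- adapted from Cruxes/MustSqueeze/NegativeNotes-StubBitsV3.lean
-- (`Drefute.integrable_cutoff_mul_frobeniusNormSq`)
/-- The cut-off Frobenius gradient density `φ_R |∇U(s)|²_F` is integrable (continuous with compact
support). [folklore] -/
theorem mustSqueeze_integrable_cutoff_mul_frobeniusNormSq {C : ℝ} {u : ℝ → ℝ³ → ℝ³}
    (hu : IsTypeIAncientMild C u) (s : ℝ) {R : ℝ} (hR : 0 < R) :
    Integrable fun y : ℝ³ => smoothTransition (2 - ‖y‖ ^ 2 / R ^ 2) *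
      frobeniusNormSq (fderiv ℝ (lerayOrbit u s) y) :=
  (((contDiff_smoothTransition_cutoff (n := 0) R).continuous).mul
    (divCurl_continuous_frobeniusNormSq_fderiv_lerayOrbit hu s)).integrable_of_hasCompactSupport
    ((hasCompactSupport_smoothTransition_cutoff hR).mul_right)

-- adapted from Cruxes/MustSqueeze/NegativeNotes-StubBitsV3.lean
-- (`Drefute.integrable_cutoff_mul_vorticity`)
/-- The cut-off enstrophy density `φ_R ‖Ω(s)‖²` is integrable (the curl of the `C¹` slice is
continuous, and the cutoff has compact support). [folklore] -/
theorem mustSqueeze_integrable_cutoff_mul_vorticity {C : ℝ} {u : ℝ → ℝ³ → ℝ³}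
    (hu : IsTypeIAncientMild C u) (s : ℝ) {R : ℝ} (hR : 0 < R) :
    Integrable fun y : ℝ³ =>
      smoothTransition (2 - ‖y‖ ^ 2 / R ^ 2) * ‖lerayVorticity u s y‖ ^ 2 := by
  rw [lerayVorticity_apply]
  exact (((contDiff_smoothTransition_cutoff (n := 0) R).continuous).mul
    (((continuous_curl (divCurl_contDiff_lerayOrbit_slice hu s (n := 1))).norm).pow 2))
    |>.integrable_of_hasCompactSupport ((hasCompactSupport_smoothTransition_cutoff hR).mul_right)

/-- A continuous real function on `ℝ³` is integrable on every ball (it is integrable on the compact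
closed ball). [folklore] -/
theorem mustSqueeze_integrableOn_ball_of_continuous {f : ℝ³ → ℝ} (hf : Continuous f) (ρ : ℝ) :
    IntegrableOn f (ball (0 : ℝ³) ρ) :=
  (hf.continuousOn.integrableOn_compact (isCompact_closedBall (0 : ℝ³) ρ)).mono_set
    ball_subset_closedBall

/-! ## (iii) and (iv): plateau and monotonicity of the cutoff -/

-- adapted from Cruxes/MustSqueeze/NegativeNotes-StubBitsV3.lean
-- (`Drefute.ballGradEnergy_le_cutoff`)
/-- **(iii)** `E(R) ≤ ∫ φ_R |∇U|²_F`: the cutoff equals `1` on `B_R` and the integrand is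
nonnegative. [folklore] -/
theorem mustSqueeze_ballGradEnergy_le_cutoff {C : ℝ} {u : ℝ → ℝ³ → ℝ³}
    (hu : IsTypeIAncientMild C u) (s : ℝ) {R : ℝ} (hR : 0 < R) :
    (∫ y in ball (0 : ℝ³) R, frobeniusNormSq (fderiv ℝ (lerayOrbit u s) y)) ≤
      ∫ y, smoothTransition (2 - ‖y‖ ^ 2 / R ^ 2) *
        frobeniusNormSq (fderiv ℝ (lerayOrbit u s) y) := by
  have hint := mustSqueeze_integrable_cutoff_mul_frobeniusNormSq hu s hR
  calc (∫ y in ball (0 : ℝ³) R, frobeniusNormSq (fderiv ℝ (lerayOrbit u s) y))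
      = ∫ y in ball (0 : ℝ³) R, smoothTransition (2 - ‖y‖ ^ 2 / R ^ 2) *
          frobeniusNormSq (fderiv ℝ (lerayOrbit u s) y) := by
        refine setIntegral_congr_fun measurableSet_ball fun y hy => ?_
        rw [mem_ball, dist_zero_right] at hy
        rw [smoothTransition_cutoff_eq_one hR hy.le, one_mul]
    _ ≤ ∫ y, smoothTransition (2 - ‖y‖ ^ 2 / R ^ 2) *
          frobeniusNormSq (fderiv ℝ (lerayOrbit u s) y) :=
        setIntegral_le_integral hint (Eventually.of_forall fun y =>
          mul_nonneg (smoothTransition_cutoff_nonneg R y) (frobeniusNormSq_nonneg _))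

-- adapted from Cruxes/MustSqueeze/NegativeNotes-StubBitsV3.lean
-- (`Drefute.cutoffEnstrophy_mono`)
/-- **(iv)** `Z_R ≤ Z_{R'}` for `0 < R ≤ R'`: the cutoffs are pointwise ordered since
`2 − ‖y‖²/R² ≤ 2 − ‖y‖²/R'²` and `smoothTransition` is monotone. [folklore] -/
theorem mustSqueeze_cutoffEnstrophy_mono {C : ℝ} {u : ℝ → ℝ³ → ℝ³}
    (hu : IsTypeIAncientMild C u) (s : ℝ) {R R' : ℝ} (hR : 0 < R) (hRR' : R ≤ R') :
    (∫ y, smoothTransition (2 - ‖y‖ ^ 2 / R ^ 2) * ‖lerayVorticity u s y‖ ^ 2) ≤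
      ∫ y, smoothTransition (2 - ‖y‖ ^ 2 / R' ^ 2) * ‖lerayVorticity u s y‖ ^ 2 := by
  have hR' : 0 < R' := lt_of_lt_of_le hR hRR'
  refine integral_mono (mustSqueeze_integrable_cutoff_mul_vorticity hu s hR)
    (mustSqueeze_integrable_cutoff_mul_vorticity hu s hR') fun y => ?_
  refine mul_le_mul_of_nonneg_right (Real.smoothTransition.monotone ?_) (sq_nonneg _)
  have h : ‖y‖ ^ 2 / R' ^ 2 ≤ ‖y‖ ^ 2 / R ^ 2 :=
    div_le_div_of_nonneg_left (sq_nonneg _) (by positivity) (pow_le_pow_left₀ hR.le hRR' 2)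
  linarith

/-! ## (i): `Z_R ≤ 6 E(2R)` -/

-- adapted from Cruxes/MustSqueeze/NegativeNotes-StubBitsV3.lean
-- (`Drefute.cutoffEnstrophy_le_six_ballGradEnergy`)
/-- **(i)** `Z_R ≤ 6 E(2R)` (in fact `≤ 2 E(2R)`): the cut-off enstrophy density vanishes off the
closed ball `B̄_{2R}` (which agrees with the open ball up to a null set), and on it
`φ_R |curl U|² ≤ 1 · 2 |∇U|²_F` pointwise. [folklore] -/
theorem mustSqueeze_cutoffEnstrophy_le_six_ballGradEnergy {C : ℝ} {u : ℝ → ℝ³ → ℝ³}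
    (hu : IsTypeIAncientMild C u) (s : ℝ) {R : ℝ} (hR : 0 < R) :
    (∫ y, smoothTransition (2 - ‖y‖ ^ 2 / R ^ 2) * ‖lerayVorticity u s y‖ ^ 2) ≤
      6 * ∫ y in ball (0 : ℝ³) (2 * R), frobeniusNormSq (fderiv ℝ (lerayOrbit u s) y) := by
  have hI := mustSqueeze_integrable_cutoff_mul_vorticity hu s hR
  have hfi : IntegrableOn (fun y => 2 * frobeniusNormSq (fderiv ℝ (lerayOrbit u s) y))
      (ball (0 : ℝ³) (2 * R)) :=
    mustSqueeze_integrableOn_ball_of_continuous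
      (continuous_const.mul (divCurl_continuous_frobeniusNormSq_fderiv_lerayOrbit hu s)) _
  -- the integrand vanishes off `closedBall 0 (2R)`, and the sphere is null
  have h1 : (∫ y, smoothTransition (2 - ‖y‖ ^ 2 / R ^ 2) * ‖lerayVorticity u s y‖ ^ 2) =
      ∫ y in ball (0 : ℝ³) (2 * R),
        smoothTransition (2 - ‖y‖ ^ 2 / R ^ 2) * ‖lerayVorticity u s y‖ ^ 2 := by
    rw [← setIntegral_eq_integral_of_forall_compl_eq_zero (s := closedBall (0 : ℝ³) (2 * R))
      (fun y hy => by rw [smoothTransition_cutoff_eq_zero_of_notMem hR hy, zero_mul]),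
      setIntegral_congr_set (divCurl_ball_ae_eq_closedBall (2 * R))]
  -- pointwise `φ |Ω|² ≤ 1 · 2 |∇U|²_F`
  have h2 : (∫ y in ball (0 : ℝ³) (2 * R),
        smoothTransition (2 - ‖y‖ ^ 2 / R ^ 2) * ‖lerayVorticity u s y‖ ^ 2) ≤
      ∫ y in ball (0 : ℝ³) (2 * R), 2 * frobeniusNormSq (fderiv ℝ (lerayOrbit u s) y) := by
    refine setIntegral_mono_on hI.integrableOn hfi measurableSet_ball fun y _ => ?_
    calc smoothTransition (2 - ‖y‖ ^ 2 / R ^ 2) * ‖lerayVorticity u s y‖ ^ 2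
        ≤ 1 * (2 * frobeniusNormSq (fderiv ℝ (lerayOrbit u s) y)) :=
          mul_le_mul (smoothTransition_cutoff_le_one R y)
            (by rw [lerayVorticity_apply]; exact norm_curl_sq_le_two_mul_frobeniusNormSq _ _)
            (sq_nonneg _) zero_le_one
      _ = 2 * frobeniusNormSq (fderiv ℝ (lerayOrbit u s) y) := one_mul _
  have h3 : 0 ≤ ∫ y in ball (0 : ℝ³) (2 * R), frobeniusNormSq (fderiv ℝ (lerayOrbit u s) y) :=
    setIntegral_nonneg measurableSet_ball fun _ _ => frobeniusNormSq_nonneg _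
  rw [integral_const_mul] at h2
  linarith

/-! ## (ii): the div–curl comparison `∫ φ_R |∇U|²_F ≤ Z_R + κ' √(E(2R)/R)` -/

/-- **The div–curl identity against a cutoff.** For a divergence-free `C²` field `U` and a `C¹`
compactly supported weight `φ`,
`∫ φ |∇U|²_F = ∫ φ |curl U|² − ∫ ⟪(U·∇)U, ∇φ⟫`:
pointwise `|∇U|²_F = |curl U|² + tr (∇U ∘ ∇U)`, `tr (∇U ∘ ∇U) = div ((U·∇)U)` since `div U = 0`,
and `∫ φ div ((U·∇)U) = −∫ ⟪(U·∇)U, ∇φ⟫` (no boundary terms). [folklore] -/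
theorem mustSqueeze_integral_mul_frobeniusNormSq_eq {U : ℝ³ → ℝ³} {φ : ℝ³ → ℝ}
    (hU : ContDiff ℝ 2 U) (hdiv : VectorCalculus.IsDivFree U) (hφ : ContDiff ℝ 1 φ)
    (hφc : HasCompactSupport φ) :
    ∫ y, φ y * frobeniusNormSq (fderiv ℝ U y) =
      (∫ y, φ y * ‖curl U y‖ ^ 2) - ∫ y, ⟪convect U U y, gradient φ y⟫ := by
  have hU1 : ContDiff ℝ 1 U := hU.of_le (by norm_num)
  -- `(U·∇)U ∈ C¹`
  have hW : ContDiff ℝ 1 (convect U U) := by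
    have e : convect U U = fun x => fderiv ℝ U x (U x) := rfl
    rw [e]
    exact (hU.fderiv_right (m := 1) le_rfl).clm_apply hU1
  -- pointwise splitting of the density
  have hpt : ∀ y, φ y * frobeniusNormSq (fderiv ℝ U y) =
      φ y * ‖curl U y‖ ^ 2 + φ y * VectorCalculus.divergence (convect U U) y := by
    intro y
    rw [frobeniusNormSq_fderiv_eq_sq_norm_curl_add_trace, divergence_convect_self_eq hU hdiv y,
      mul_add]
  have hI1 : Integrable fun y => φ y * ‖curl U y‖ ^ 2 :=
    (hφ.continuous.mul (((continuous_curl hU1).norm).pow 2)).integrable_of_hasCompactSupport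
      hφc.mul_right
  have hI2 : Integrable fun y => φ y * VectorCalculus.divergence (convect U U) y :=
    (hφ.continuous.mul (continuous_divergence (hW.continuous_fderiv one_ne_zero)))
      |>.integrable_of_hasCompactSupport hφc.mul_right
  have hibp := integral_mul_divergence_add_eq_zero_left hφ hW hφc
  rw [integral_congr_ae (Eventually.of_forall hpt), integral_add hI1 hI2]
  linarith

/-- **`L²` Cauchy–Schwarz on a ball for continuous densities**: for continuous `f, g : ℝ³ → ℝ`,
`∫_{B_ρ} f g ≤ √(∫_{B_ρ} f²) √(∫_{B_ρ} g²)` (both are bounded on the compact closed ball, hence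
square integrable on the ball of finite volume). [folklore] -/
theorem mustSqueeze_setIntegral_ball_mul_le_sqrt_mul_sqrt {f g : ℝ³ → ℝ} (hf : Continuous f)
    (hg : Continuous g) (ρ : ℝ) :
    ∫ y in ball (0 : ℝ³) ρ, f y * g y ≤
      Real.sqrt (∫ y in ball (0 : ℝ³) ρ, f y ^ 2) *
        Real.sqrt (∫ y in ball (0 : ℝ³) ρ, g y ^ 2) := by
  haveI : IsFiniteMeasure ((volume : Measure ℝ³).restrict (ball (0 : ℝ³) ρ)) :=
    isFiniteMeasure_restrict.2 measure_ball_lt_top.ne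
  have hmem : ∀ {h : ℝ³ → ℝ}, Continuous h →
      MemLp h 2 ((volume : Measure ℝ³).restrict (ball (0 : ℝ³) ρ)) := by
    intro h hh
    obtain ⟨M, hM⟩ := (isCompact_closedBall (0 : ℝ³) ρ).exists_bound_of_continuousOn hh.continuousOn
    exact MemLp.of_bound hh.aestronglyMeasurable M
      (ae_restrict_of_forall_mem measurableSet_ball fun y hy => hM y (ball_subset_closedBall hy))
  exact integral_mul_le_sqrt_mul_sqrt_of_memLp (hmem hf) (hmem hg)

/-- **The flux bound.** For a `C¹` field `U` and a weight `φ` supported in the closed ball `B̄_ρ`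
with `‖∇φ‖ ≤ c`,
`‖∫ ⟪(U·∇)U, ∇φ⟫‖ ≤ c √(∫_{B_ρ} |∇U|²_F) √(∫_{B_ρ} ‖U‖²)`
(the integrand lives on `B̄_ρ`, which agrees with `B_ρ` up to a null set; pointwise
`|⟪∇U·U, ∇φ⟫| ≤ ‖∇U‖_op ‖U‖ ‖∇φ‖ ≤ c |∇U|_F ‖U‖`; then Cauchy–Schwarz on the ball). [folklore] -/
theorem mustSqueeze_norm_integral_inner_convect_gradient_le {U : ℝ³ → ℝ³} {φ : ℝ³ → ℝ}
    (hU : ContDiff ℝ 1 U) {ρ c : ℝ} (hsupp : tsupport φ ⊆ closedBall (0 : ℝ³) ρ)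
    (hc : ∀ y, ‖fderiv ℝ φ y‖ ≤ c) :
    ‖∫ y, ⟪convect U U y, gradient φ y⟫‖ ≤
      c * (Real.sqrt (∫ y in ball (0 : ℝ³) ρ, frobeniusNormSq (fderiv ℝ U y)) *
        Real.sqrt (∫ y in ball (0 : ℝ³) ρ, ‖U y‖ ^ 2)) := by
  have hUc : Continuous U := hU.continuous
  have hfrob : Continuous fun y => frobeniusNormSq (fderiv ℝ U y) :=
    continuous_frobeniusNormSq_fderiv hU one_ne_zero
  have hsqrt : Continuous fun y => Real.sqrt (frobeniusNormSq (fderiv ℝ U y)) :=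
    continuous_sqrt.comp hfrob
  -- the flux integrand vanishes off the closed ball
  have hzero : ∀ y, y ∉ closedBall (0 : ℝ³) ρ → ⟪convect U U y, gradient φ y⟫ = 0 := by
    intro y hy
    rw [gradient_eq_zero_of_notMem_tsupport (fun h => hy (hsupp h)), inner_zero_right]
  have hball : ∫ y, ⟪convect U U y, gradient φ y⟫ =
      ∫ y in ball (0 : ℝ³) ρ, ⟪convect U U y, gradient φ y⟫ := by
    rw [← setIntegral_eq_integral_of_forall_compl_eq_zero hzero,
      setIntegral_congr_set (divCurl_ball_ae_eq_closedBall ρ)]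
  -- pointwise bound of the integrand
  have hpt : ∀ y, ‖⟪convect U U y, gradient φ y⟫‖ ≤
      c * (Real.sqrt (frobeniusNormSq (fderiv ℝ U y)) * ‖U y‖) := by
    intro y
    have hg : ‖gradient φ y‖ = ‖fderiv ℝ φ y‖ := by
      unfold gradient
      exact LinearIsometryEquiv.norm_map _ _
    have hop : ‖fderiv ℝ U y‖ ≤ Real.sqrt (frobeniusNormSq (fderiv ℝ U y)) :=
      Real.le_sqrt_of_sq_le (sq_opNorm_le_frobeniusNormSq _)
    have hc0 : 0 ≤ c := (norm_nonneg _).trans (hc y)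
    calc ‖⟪convect U U y, gradient φ y⟫‖ ≤ ‖convect U U y‖ * ‖gradient φ y‖ :=
          norm_inner_le_norm _ _
      _ ≤ (‖fderiv ℝ U y‖ * ‖U y‖) * c := by
          refine mul_le_mul ?_ (hg ▸ hc y) (norm_nonneg _) (by positivity)
          rw [convect_apply]
          exact ContinuousLinearMap.le_opNorm _ _
      _ ≤ (Real.sqrt (frobeniusNormSq (fderiv ℝ U y)) * ‖U y‖) * c := by gcongr
      _ = c * (Real.sqrt (frobeniusNormSq (fderiv ℝ U y)) * ‖U y‖) := mul_comm _ _
  -- integrate the pointwise bound on the ball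
  have hint : IntegrableOn (fun y => c * (Real.sqrt (frobeniusNormSq (fderiv ℝ U y)) * ‖U y‖))
      (ball (0 : ℝ³) ρ) :=
    mustSqueeze_integrableOn_ball_of_continuous (continuous_const.mul (hsqrt.mul hUc.norm)) ρ
  have h1 : ‖∫ y in ball (0 : ℝ³) ρ, ⟪convect U U y, gradient φ y⟫‖ ≤
      ∫ y in ball (0 : ℝ³) ρ, c * (Real.sqrt (frobeniusNormSq (fderiv ℝ U y)) * ‖U y‖) :=
    norm_integral_le_of_norm_le hint (Eventually.of_forall hpt)
  rw [integral_const_mul] at h1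
  -- Cauchy–Schwarz on the ball
  have h2 := mustSqueeze_setIntegral_ball_mul_le_sqrt_mul_sqrt hsqrt hUc.norm ρ
  have h3 : (∫ y in ball (0 : ℝ³) ρ, Real.sqrt (frobeniusNormSq (fderiv ℝ U y)) ^ 2) =
      ∫ y in ball (0 : ℝ³) ρ, frobeniusNormSq (fderiv ℝ U y) :=
    integral_congr_ae (Eventually.of_forall fun y => Real.sq_sqrt (frobeniusNormSq_nonneg _))
  rw [h3] at h2
  have hc0 : 0 ≤ c := (norm_nonneg _).trans (hc 0)
  rw [hball]
  exact h1.trans (mul_le_mul_of_nonneg_left h2 hc0)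

/-- The topological support of the scale-`R` cutoff lies in the closed ball of radius `2R`.
[folklore] -/
theorem mustSqueeze_tsupport_cutoff_subset {R : ℝ} (hR : 0 < R) :
    tsupport (fun y : ℝ³ => smoothTransition (2 - ‖y‖ ^ 2 / R ^ 2)) ⊆
      closedBall (0 : ℝ³) (2 * R) := by
  refine closure_minimal (fun y hy => ?_) isClosed_closedBall
  rw [mem_closedBall, dist_zero_right]
  by_contra h
  exact hy (smoothTransition_cutoff_eq_zero hR (not_le.1 h).le)

/-- Slices of the similarity orbit of a class element are divergence free
(`div U(s) = 0 ↔ div u(−e^{−s}) = 0`). [folklore] -/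
theorem mustSqueeze_isDivFree_lerayOrbit {C : ℝ} {u : ℝ → ℝ³ → ℝ³} (hu : IsTypeIAncientMild C u)
    (s : ℝ) : VectorCalculus.IsDivFree (lerayOrbit u s) :=
  (isDivFree_lerayOrbit_iff u s).2 (hu.isDivFree (neg_lt_zero.2 (Real.exp_pos _)))

/-- **(ii)** `∫ φ_R |∇U|²_F ≤ Z_R + c √(2C) √(E(2R)/R)` for `R > 0`, where `c` is the scale-free
constant of the gradient bound `‖∇φ_R‖ ≤ c/R` and `∫_{B_ρ(y₀)} ‖U(s)‖² ≤ Cρ` is the Morrey bound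
(div–curl identity, flux bound on `B_{2R}`, and `√(∫_{B_{2R}} ‖U‖²) ≤ √(2CR)`). [folklore] -/
theorem mustSqueeze_cutoff_frobeniusNormSq_le {C : ℝ} {u : ℝ → ℝ³ → ℝ³}
    (hu : IsTypeIAncientMild C u)
    (hM : ∀ (s : ℝ) (y₀ : ℝ³) (ρ : ℝ), 0 < ρ →
      ∫ y in ball y₀ ρ, ‖lerayOrbit u s y‖ ^ 2 ≤ C * ρ)
    {c : ℝ} (hc0 : 0 ≤ c)
    (hc : ∀ R : ℝ, 0 < R → ∀ y : ℝ³,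
      ‖fderiv ℝ (fun z : ℝ³ => smoothTransition (2 - ‖z‖ ^ 2 / R ^ 2)) y‖ ≤ c / R)
    (s : ℝ) {R : ℝ} (hR : 0 < R) :
    (∫ y, smoothTransition (2 - ‖y‖ ^ 2 / R ^ 2) *
        frobeniusNormSq (fderiv ℝ (lerayOrbit u s) y)) ≤
      (∫ y, smoothTransition (2 - ‖y‖ ^ 2 / R ^ 2) * ‖lerayVorticity u s y‖ ^ 2) +
        c * Real.sqrt (2 * C) * Real.sqrt ((∫ y in ball (0 : ℝ³) (2 * R),
          frobeniusNormSq (fderiv ℝ (lerayOrbit u s) y)) / R) := by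
  have hU2 : ContDiff ℝ 2 (lerayOrbit u s) := divCurl_contDiff_lerayOrbit_slice hu s (n := 2)
  have hU1 : ContDiff ℝ 1 (lerayOrbit u s) := divCurl_contDiff_lerayOrbit_slice hu s (n := 1)
  have hφ : ContDiff ℝ 1 fun y : ℝ³ => smoothTransition (2 - ‖y‖ ^ 2 / R ^ 2) :=
    contDiff_smoothTransition_cutoff R
  have hφc := hasCompactSupport_smoothTransition_cutoff (E := ℝ³) hR
  -- the div–curl identity
  have hid := mustSqueeze_integral_mul_frobeniusNormSq_eq hU2
    (mustSqueeze_isDivFree_lerayOrbit hu s) hφ hφc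
  -- the flux bound on `B_{2R}`
  have hflux := mustSqueeze_norm_integral_inner_convect_gradient_le hU1
    (mustSqueeze_tsupport_cutoff_subset hR) (hc R hR)
  -- the Morrey bound at radius `2R`
  have hMor : Real.sqrt (∫ y in ball (0 : ℝ³) (2 * R), ‖lerayOrbit u s y‖ ^ 2) ≤
      Real.sqrt (2 * C) * Real.sqrt R := by
    rw [← Real.sqrt_mul (mul_nonneg zero_le_two hu.nonneg)]
    refine Real.sqrt_le_sqrt ?_
    have := hM s 0 (2 * R) (by positivity)
    linarith
  set E₂ : ℝ := ∫ y in ball (0 : ℝ³) (2 * R), frobeniusNormSq (fderiv ℝ (lerayOrbit u s) y)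
    with hE₂
  -- algebra: `(c/R) √E₂ (√(2C) √R) = c √(2C) √(E₂/R)`
  have hRs : 0 < Real.sqrt R := Real.sqrt_pos.2 hR
  have hkey : c / R * (Real.sqrt E₂ * (Real.sqrt (2 * C) * Real.sqrt R)) =
      c * Real.sqrt (2 * C) * Real.sqrt (E₂ / R) := by
    rw [Real.sqrt_div' E₂ hR.le]
    have hsq : Real.sqrt R * Real.sqrt R = R := Real.mul_self_sqrt hR.le
    field_simp
    linear_combination (c * Real.sqrt E₂ * Real.sqrt (2 * C)) * hsq
  have hbound : ‖∫ y, ⟪convect (lerayOrbit u s) (lerayOrbit u s) y,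
      gradient (fun z : ℝ³ => smoothTransition (2 - ‖z‖ ^ 2 / R ^ 2)) y⟫‖ ≤
      c * Real.sqrt (2 * C) * Real.sqrt (E₂ / R) := by
    rw [← hkey]
    exact hflux.trans (mul_le_mul_of_nonneg_left
      (mul_le_mul_of_nonneg_left hMor (Real.sqrt_nonneg _)) (div_nonneg hc0 hR.le))
  rw [hid]
  have hneg := neg_le_abs (∫ y, ⟪convect (lerayOrbit u s) (lerayOrbit u s) y,
      gradient (fun z : ℝ³ => smoothTransition (2 - ‖z‖ ^ 2 / R ^ 2)) y⟫)
  rw [Real.norm_eq_abs] at hbound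
  simp only [lerayVorticity_apply]
  linarith

/-! ## The stub -/

/-- **stub_divCurlBalls** — comparison lemmas between the localised enstrophy
`Z_R(s) = ∫ φ_R |Ω(s)|²` and the ball gradient energies (`|Ω|² ≤ 2|∇U|²_F`,
`|Ω|² = |∇U|²_F − tr(∇U²)`, `∫ φ tr(∇U²) = −∫ ∇φ·((U·∇)U)` for `div U = 0`, Cauchy–Schwarz with
`∫_{B_{2R}}|U|² ≤ 2CR` and `‖∇φ_R‖ ≤ c/R`; `φ_R = 1` on `B_R`, `φ_R ≤ φ_{R'}` for `R ≤ R'`). -/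
theorem stub_divCurlBalls : ∀ (C : ℝ) (u : ℝ → ℝ³ → ℝ³), IsTypeIAncientMild C u →
    (∀ (s : ℝ) (y₀ : ℝ³) (ρ : ℝ), 0 < ρ →
      ∫ y in Metric.ball y₀ ρ, ‖lerayOrbit u s y‖ ^ 2 ≤ C * ρ) →
    ∃ κ' : ℝ, ∀ (R s : ℝ), 1 ≤ R →
      (∫ y, Real.smoothTransition (2 - ‖y‖ ^ 2 / R ^ 2) * ‖lerayVorticity u s y‖ ^ 2) ≤
          6 * ∫ y in Metric.ball (0 : ℝ³) (2 * R), frobeniusNormSq (fderiv ℝ (lerayOrbit u s) y) ∧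
      (∫ y, Real.smoothTransition (2 - ‖y‖ ^ 2 / R ^ 2) * frobeniusNormSq (fderiv ℝ (lerayOrbit u s) y)) ≤
          (∫ y, Real.smoothTransition (2 - ‖y‖ ^ 2 / R ^ 2) * ‖lerayVorticity u s y‖ ^ 2) +
            κ' * Real.sqrt ((∫ y in Metric.ball (0 : ℝ³) (2 * R),
              frobeniusNormSq (fderiv ℝ (lerayOrbit u s) y)) / R) ∧
      (∫ y in Metric.ball (0 : ℝ³) R, frobeniusNormSq (fderiv ℝ (lerayOrbit u s) y)) ≤
          (∫ y, Real.smoothTransition (2 - ‖y‖ ^ 2 / R ^ 2) * frobeniusNormSq (fderiv ℝ (lerayOrbit u s) y)) ∧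
      (∀ R' : ℝ, R ≤ R' →
        (∫ y, Real.smoothTransition (2 - ‖y‖ ^ 2 / R ^ 2) * ‖lerayVorticity u s y‖ ^ 2) ≤
          (∫ y, Real.smoothTransition (2 - ‖y‖ ^ 2 / R' ^ 2) * ‖lerayVorticity u s y‖ ^ 2)) := by
  intro C u hu hM
  obtain ⟨c, hc0, hc⟩ := exists_norm_fderiv_smoothTransition_cutoff_le (E := ℝ³)
  refine ⟨c * Real.sqrt (2 * C), fun R s hR1 => ?_⟩
  have hR : 0 < R := one_pos.trans_le hR1
  exact ⟨mustSqueeze_cutoffEnstrophy_le_six_ballGradEnergy hu s hR,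
    mustSqueeze_cutoff_frobeniusNormSq_le hu hM hc0 hc s hR,
    mustSqueeze_ballGradEnergy_le_cutoff hu s hR,
    fun _R' hRR' => mustSqueeze_cutoffEnstrophy_mono hu s hR hRR'⟩

end Summit.NavierStokesRegularity.NavierStokesRegularity.Theorems

end
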